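import Literature.MathematicalPhysics.QuantumFieldTheory.Balaban1983to89.B9CoReadingCoordsHolder
import Literature.MathematicalPhysics.QuantumFieldTheory.Balaban1983to89.B9CoReadingCoordsL2S

/-!
# `Balaban1983to89.B9CoReadingCoordsHolderS` — the HÖLDER PROBES of the κ-fold coordinate model, SITE SECTOR: the (3.43) co-reading `H1ReadsNbr` of def-Y's
# reading `kernelFamilyS` (G′(U)) HOLDS AT THE COORDINATE PINS, for every site-sector letter and EVERY configuration `U`

T. Bałaban, *Propagators for lattice gauge theories in a background field*, Commun. Math. Phys. **99** (1985) 389–434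
[`Balaban1985BackgroundPropagators`, "B9"]; [4] = T. Bałaban, *Propagators and renormalization transformations for lattice gauge
theories. II*, Commun. Math. Phys. **96** (1984) 223–250 [`Balaban1984PropagatorsII`].

statement-level skeleton of published theorems with citation tags; proofs where landed; nothing here is a claim about the
Yang–Mills mass gap

THE PRINTED LOCI.  [B9] (3.40) p. 397 (the covariant Hölder quotient, site sector: *"|U(Γ_{x,x′})λ(x′) − λ(x)| ∕ |x − x′|^α"*), (3.43) p. 398
(*"‖ζ∇_U G′(U)λ‖_α, ‖ζG′(U)∇\*_Uλ‖_α ≦ B₀(α)(Lʲη)^{1−α}(‖ζ‖^ξ_α + |ζ|)e^{−δ₀d(y,y′)}|λ|"*), (3.41)–(3.42) p. 397 (print's units `η`);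
[4] Prop. 2.2 (2.67) p. 234 (`‖ζ‖_α`, the torus distance), (2.51)–(2.52) p. 232.

WHY THIS FILE (seat n06-d g6; the site twin of `B9CoReadingCoordsHolder`).  The N06 certificate displays `hH1 : H1ReadsNbr ((ops x).Gp) U (𝔭 x) (RelB …) 2
(𝔬 x).blk (𝔬 x).blkY evSK evSK (D ∘ₗ Gp) (Gp ∘ₗ Dstar)` over a FREE probe family `𝔭` on the site carrier `XSK (TrIdx N)`.  def-Y's site reading
`kernelFamilyS.h1` is `sup_{‖E‖≤1} sup_{(μ, side)} hqS (U(Γ)) α (ζη·∇^η_{U,μ}O(f⊗E) ∕ ζη·O∇^{η*}_{U,μ}(f⊗E))` with the torus quotient `hqS` over ALL pairs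
`z ≠ z′` (weight `(η|z′ − z|_T)^{−α}`), against the cut-off class `(geoTP).cutH α ζ = ‖ζ‖_α + |ζ|` (`hqTP + supF`, the SAME pairs and weight).  THIS FILE: the
pair weight `wS α x x′ := ((|x′ − x|_T η)^α)⁻¹`, the probe letters ★ `holderProbesS i b B cfg par bI` (`probeK` of `B9CoReadingCoordsHolder` with `wS` and the unit
point weight — the prefactor `η` of the site members is carried by the models `DcoS ∘ₗ GcoS = (η·cR39) • coordOpK (∇ ∘ O)`), ★★ `hqS_le_of_probes` (the product rule:
`ζ(x′)ηRΨ(x′) − ζ(x)ηΨ(x) = ζ(x)η(RΨ(x′) − Ψ(x)) + (ζ(x′) − ζ(x))ηRΨ(x′)`, one term per probe family; `B6Prop22KLevelTorusCensusEta.pair_le_hqTP`), ★★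
`h1ReadsNbr_kernelFamilyS_coords` and ★ `site_h1ReadsNbr_of_pins` (the certificate's pins `blk = blkSK (sIK bI)`, `Gp = GcoS`, `D = DcoS`, `Dstar = DscoS`,
radius 2; any `r ≥ 1` works) — the binder `hH1` becomes a `have` once `𝔭 := holderProbesS …`.
HONEST SCOPE.  Finite-dimensional bookkeeping; nothing of [B9] or [4] asserted; COUNT-NEUTRAL; N06 NOT discharged; one finite 𝕋^{d+1} programme at fixed ε —
nothing continuum, nothing about the mass gap.  Cell `pub-ymgap` (HUMAN RULING D-0062), Track A node N06 [B9], seat `pub-ymgap-dag-n06-d` (g6), 2026-08-27.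
-/

noncomputable section

namespace Literature.MathematicalPhysics.QuantumFieldTheory.Balaban1983to89.B9CoReadingCoordsHolderS

open B9Eq39Adjoint (R R_sub R_smul R_zero)
open B4TorusKernel.MultiPeriod (torusSupNorm torusSupNorm_nonneg)
open B6GlobalChartV1 (PV domT blkV1)
open B6Geom246MultiLevelBox (bset blkOf)
open B6Geom246MultiLevelTorus (geomT triangle_refl_nonneg_T)
open B6Ineq2142KLevelV1 (β lvl)
open B6KLevelCensusIndexV1 (KIdx)
open B6Prop22KLevelTorusCensus (KTIdx)
open B6MultiLevelTorusOperator (one_le_N0)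
open B6Prop22KLevelTorusCensusEta (nKT nKT_pos hqTP hqTP_nonneg pair_le_hqTP geoTP)
open B9GeoNormsKLevelV1 (geo9K geo9K_supNorm_nonneg geo9K_cutH_nonneg)
open B9GeoLemma21KLevelV1 (one_le_Mh one_le_P)
open B9CoRealizesRelAtLetters (RelB)
open B9RWSumsReadsNbr (H1ReadsNbr)
open B9RWSums343Holder (HolderProbes)
open B9Ineq349SiteComposite (cdSL cdsSL etaS_pos)
open B9Thm39ReadingCoords (cR39 cR39_nonneg)
open B9CoReadingCoords (assembleK assembleK_smul evDiagK assembleK_evDiagK coordOpK assembleK_coordOpK coordOpK_evDiagK)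
open B9CoReadingCoordsS (XSK evSK blkSK sIK sIK_faithful blkV1_site GcoS DcoS DscoS DcoS_comp_GcoS GcoS_comp_DscoS off_bound_evSK)
open B9CoReadingCoordsL2S (sIK_dist_le_one)
open B9CoReadingCoordsHolder (PK blkPK probeK probeK_inl probeK_inr_inl probeK_inr_inr shiftR transR wnorm_le_of_coords)
open Node00 (SiteY FBondY IBondY CfgY BallY liftY liftY_apply hqS hLatS etaS toKT kernelFamilyS SiteOpY SiteParY cdS cdsS iSup_ball_le)

variable {d ℓ : ℕ} {hd : 1 ≤ d + 1} {hL : Odd (ℓ + 1) ∧ 1 < ℓ + 1} {b₀ b₁ : ℝ}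
variable {𝔸 : Type} [NormedRing 𝔸] [NormedAlgebra ℂ 𝔸] [CompleteSpace 𝔸]
variable {κ : Type} [Fintype κ] [DecidableEq κ]

/-! ## §1 The site pair weight, the probe letters, the product rule for `hqS` -/

section Site

variable (i : KIdx d ℓ hd hL b₀ b₁)

/-- the pair weight of the SITE quotient (3.40): `((|x′ − x|_T · η)^α)⁻¹` — the reciprocal of the denominator INSIDE def-Y's `hqS` (and inside `hqTP`).
[cite: Balaban1985BackgroundPropagators, (3.40) p.397; Balaban1984PropagatorsII, (2.67) p.234] -/
def wS (α : ℝ) (x x' : SiteY i) : ℝ := ((torusSupNorm (toKT i).NB (x'.1 - x.1) / (nKT (toKT i))) ^ α)⁻¹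

omit [CompleteSpace 𝔸] in
/-- `0 ≤ wS`. [cite: Balaban1985BackgroundPropagators, (3.40) p.397, bookkeeping] -/
theorem wS_nonneg (α : ℝ) (x x' : SiteY i) : 0 ≤ wS i α x x' :=
  inv_nonneg.2 (Real.rpow_nonneg (div_nonneg (torusSupNorm_nonneg (fun μ => one_le_N0 (toKT i).hMh (toKT i).hP μ) _) (nKT_pos (toKT i)).le) _)

variable (b : Module.Basis κ ℝ 𝔸) [FiniteDimensional ℝ 𝔸] (B : B9.Backgrounds) (cfg : B.Cfg → CfgY 𝔸 i) (par : SiteParY 𝔸 i)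

/-- ★ **THE HÖLDER PROBES OF THE SITE COORDINATE MODEL**: `probeK` with the site pair weight `wS α` and the unit point weight, anchored through `sIK bI`.
[cite: Balaban1985BackgroundPropagators, (3.40) p.397 + (3.43) p.398; Balaban1984PropagatorsII, (2.51) p.232] -/
def holderProbesS (bI : FBondY i → IBondY i) :
    HolderProbes (geo9K i) B (XSK κ i) (XSK κ i) (PK (SiteY i) (Fin (d + 1)) κ) (PK (SiteY i) (Fin (d + 1)) κ) where
  blkPX := blkPK (sIK i bI)
  blkPY := blkPK (sIK i bI)
  ΦX := fun U α => probeK b (fun x x' : SiteY i => par (cfg U) x x') (wS i α) (fun _ => 1)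
  ΦY := fun U α => probeK b (fun x x' : SiteY i => par (cfg U) x x') (wS i α) (fun _ => 1)

variable {bI : FBondY i → IBondY i}

/-- ★★ **THE PRODUCT RULE FOR THE SITE QUOTIENT `hqS`, READ THROUGH THE PROBES.**  Let `sI` be 1-faithful on sites and `1 ≤ r`; let `ζ` be supported in the
block `β y` (`cutIn`, site cut-offs).  If every probe of the `(η·cR39)`-scaled coordinate model of the family `T` at `evDiagK f`, anchored within `r` of `y`, is
`≤ c` in absolute value, then for `‖E‖ ≤ 1` and every slot `ν`: `hqS (U(Γ)) α (ζη · T ν (f ⊗ E)) ≤ c·(‖ζ‖_α + |ζ|)` (`(geoTP).cutH`).  Per pair `z ≠ z′`: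
`ζ(z′)ηRΨ(z′) − ζ(z)ηΨ(z) = ζ(z)η(RΨ(z′) − Ψ(z)) + (ζ(z′) − ζ(z))ηRΨ(z′)` (pair probe at `z`, transported point probe at `z′`) and the two degenerate cases;
the cut-off's pair term is `pair_le_hqTP`. [cite: Balaban1985BackgroundPropagators, (3.40) p.397 + (3.43) p.398; Balaban1984PropagatorsII, (2.51)–(2.52) p.232 + (2.67) p.234] -/
theorem hqS_le_of_probes {sI : SiteY i → IBondY i}
    (hσ1 : ∀ z : SiteY i, (geomT i.D).dist (β i.hN i.D i.hk (sI z)) (blkOf i.D.toDomains z) ≤ 1) {r : ℝ} (hr : 1 ≤ r)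
    (g : SiteY i → SiteY i → 𝔸ˣ) (T : Fin (d + 1) → (SiteY i → 𝔸) →ₗ[ℝ] (SiteY i → 𝔸)) (f : SiteY i → ℝ) (α : ℝ) (z : SiteY i → ℝ)
    (y : IBondY i) {c : ℝ} (hc : 0 ≤ c) (hcut : ∀ w, z w ≠ 0 → blkOf i.D.toDomains w = β i.hN i.D i.hk y)
    (hP : ∀ p : PK (SiteY i) (Fin (d + 1)) κ, (geomT i.D).dist (β i.hN i.D i.hk (blkPK sI p)) (β i.hN i.D i.hk y) ≤ r →
      |probeK b g (wS i α) (fun _ => (1 : ℝ)) (((etaS i * cR39 b) • coordOpK b T) (evDiagK f)) p| ≤ c)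
    (E : BallY 𝔸) (ν : Fin (d + 1)) :
    hqS i g α (fun w => ((z w * etaS i : ℝ) : ℂ) • T ν (liftY f (E : 𝔸)) w) ≤ c * (geoTP (toKT i)).cutH α z := by
  classical
  set F : XSK κ i → ℝ := ((etaS i * cR39 b) • coordOpK b T) (evDiagK f) with hF
  set Ψ : SiteY i → 𝔸 := (etaS i • T ν) (liftY f (E : 𝔸)) with hΨ
  have hE : ‖(E : 𝔸)‖ ≤ 1 := mem_closedBall_zero_iff.1 E.2
  have hη : 0 < etaS i := etaS_pos i
  -- the cut-off class `‖ζ‖_α + |ζ|`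
  set S₀ : ℝ := (toKT i).supF z with hS₀
  have hcutH : (geoTP (toKT i)).cutH α z = hqTP (toKT i) α z + S₀ := rfl
  have hS₀0 : 0 ≤ S₀ := Real.iSup_nonneg fun _ => abs_nonneg _
  have hzS : ∀ w, |z w| ≤ S₀ := fun w => le_ciSup (f := fun w => |z w|) (Finite.bddAbove_range _) w
  have hHz0 : 0 ≤ hqTP (toKT i) α z := hqTP_nonneg (toKT i) α z
  have hcH0 : 0 ≤ c * (geoTP (toKT i)).cutH α z := mul_nonneg hc (by rw [hcutH]; exact add_nonneg hHz0 hS₀0)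
  -- anchors: a site where `ζ ≠ 0` has its index bond within distance 1 ≤ r of y
  have hnear : ∀ w, z w ≠ 0 → (geomT i.D).dist (β i.hN i.D i.hk (sI w)) (β i.hN i.D i.hk y) ≤ r := by
    intro w hw
    have h := hσ1 w
    rw [hcut w hw] at h
    exact h.trans hr
  -- the slices of the scaled coordinate vector: the model of the η-scaled family
  have hFs : ∀ cc' : κ, assembleK b ν cc' F = cR39 b • (etaS i • T ν) (liftY f (b cc')) := by
    intro cc'
    rw [hF, LinearMap.smul_apply, assembleK_smul, assembleK_coordOpK, assembleK_evDiagK, LinearMap.smul_apply, smul_smul, mul_comm]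
  have hFp : ∀ (x : SiteY i) (cc cc' : κ), F (x, ν, cc, cc') = cR39 b * b.repr ((etaS i • T ν) (liftY f (b cc')) x) cc := by
    intro x cc cc'
    rw [hF, LinearMap.smul_apply, Pi.smul_apply, coordOpK_evDiagK, smul_eq_mul, LinearMap.smul_apply, Pi.smul_apply, map_smul,
      Finsupp.smul_apply, smul_eq_mul]
    ring
  -- (a) pair probe at an anchored `x`
  have hpair : ∀ x x' : SiteY i, z x ≠ 0 → wS i α x x' * ‖Ψ x - R (g x x') (Ψ x')‖ ≤ c := by
    intro x x' hx
    have h1 := fun cc cc' : κ => hP (Sum.inl ((x, x'), ν, cc, cc')) (hnear x hx)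
    refine wnorm_le_of_coords b (shiftR (g x x') x' ∘ₗ (etaS i • T ν)) f x (wS_nonneg i α x x') hc (fun cc cc' => ?_) hE
    have h2 := h1 cc cc'
    rw [probeK_inl] at h2
    simp only [hFs cc', Pi.smul_apply, R_smul, ← smul_sub, map_smul, Finsupp.smul_apply, smul_eq_mul] at h2
    exact h2
  -- (b) point probe at an anchored `x`
  have hpt : ∀ x : SiteY i, z x ≠ 0 → ‖Ψ x‖ ≤ c := by
    intro x hx
    have h1 := fun cc cc' : κ => hP (Sum.inr (Sum.inr (x, ν, cc, cc'))) (hnear x hx)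
    have key := wnorm_le_of_coords b (etaS i • T ν) f x zero_le_one hc (fun cc cc' => ?_) hE
    · rw [one_mul] at key; exact key
    have h2 := h1 cc cc'
    rw [probeK_inr_inr, hFp] at h2
    exact h2
  -- (c) transported point probe of the pair `(x, x′)`, anchored at `x′`
  have hptR : ∀ x x' : SiteY i, z x' ≠ 0 → ‖R (g x x') (Ψ x')‖ ≤ c := by
    intro x x' hx'
    have h1 := fun cc cc' : κ => hP (Sum.inr (Sum.inl ((x, x'), ν, cc, cc'))) (hnear x' hx')
    have key := wnorm_le_of_coords b (transR (g x x') x' ∘ₗ (etaS i • T ν)) f x zero_le_one hc (fun cc cc' => ?_) hE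
    · rw [one_mul] at key; exact key
    have h2 := h1 cc cc'
    rw [probeK_inr_inl] at h2
    simp only [hFs cc', Pi.smul_apply, R_smul, map_smul, Finsupp.smul_apply, smul_eq_mul] at h2
    exact h2
  -- scalar bookkeeping: the η-scaled member values
  have hns : ∀ (r : ℝ) (X : 𝔸), ‖((r : ℝ) : ℂ) • X‖ = |r| * ‖X‖ := fun r X => by rw [norm_smul, Complex.norm_real, Real.norm_eq_abs]
  have hΨw : ∀ w, ((z w * etaS i : ℝ) : ℂ) • T ν (liftY f (E : 𝔸)) w = ((z w : ℝ) : ℂ) • Ψ w := by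
    intro w
    rw [hΨ, LinearMap.smul_apply, Pi.smul_apply, ← Complex.coe_smul (etaS i), smul_smul, Complex.ofReal_mul]
  -- the sup over pairs
  unfold hqS
  refine Real.iSup_le (fun q => ?_) hcH0
  obtain ⟨x, x'⟩ := q
  split_ifs with hne
  swap
  · exact hcH0
  simp only [hΨw]
  rw [div_eq_mul_inv]
  show ‖R (g x x') (((z x' : ℝ) : ℂ) • Ψ x') - ((z x : ℝ) : ℂ) • Ψ x‖ * wS i α x x' ≤ c * (geoTP (toKT i)).cutH α z
  rw [hcutH, mul_add, mul_comm]
  have hq : ∀ v : ℝ, |v| * wS i α x x' = |v| / (torusSupNorm (toKT i).NB (x'.1 - x.1) / (nKT (toKT i))) ^ α := fun v => by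
    simp only [wS, div_eq_mul_inv]
  have hzH : |z x' - z x| * wS i α x x' ≤ hqTP (toKT i) α z := by rw [hq]; exact pair_le_hqTP (toKT i) α z x x' hne
  by_cases hx : z x = 0 <;> by_cases hx' : z x' = 0
  · rw [hx, hx']; simp only [Complex.ofReal_zero, zero_smul, R_zero, sub_zero, norm_zero, mul_zero]
    exact add_nonneg (mul_nonneg hc hHz0) (mul_nonneg hc hS₀0)
  · -- ζ(x) = 0 ≠ ζ(x′): transported point probe at x′
    rw [hx]; simp only [Complex.ofReal_zero, zero_smul, sub_zero, R_smul, hns]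
    calc wS i α x x' * (|z x'| * ‖R (g x x') (Ψ x')‖) = (|z x' - z x| * wS i α x x') * ‖R (g x x') (Ψ x')‖ := by rw [hx, sub_zero]; ring
      _ ≤ hqTP (toKT i) α z * c := mul_le_mul hzH (hptR x x' hx') (norm_nonneg _) hHz0
      _ ≤ c * hqTP (toKT i) α z + c * S₀ := by nlinarith [mul_nonneg hc hS₀0]
  · -- ζ(x) ≠ 0 = ζ(x′): point probe at x
    rw [hx']; simp only [Complex.ofReal_zero, zero_smul, R_zero, zero_sub, norm_neg, hns]
    calc wS i α x x' * (|z x| * ‖Ψ x‖) = (|z x' - z x| * wS i α x x') * ‖Ψ x‖ := by rw [hx', zero_sub, abs_neg]; ring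
      _ ≤ hqTP (toKT i) α z * c := mul_le_mul hzH (hpt x hx) (norm_nonneg _) hHz0
      _ ≤ c * hqTP (toKT i) α z + c * S₀ := by nlinarith [mul_nonneg hc hS₀0]
  · -- both non-zero: the product rule
    have hsplit : R (g x x') (((z x' : ℝ) : ℂ) • Ψ x') - ((z x : ℝ) : ℂ) • Ψ x =
        ((z x : ℝ) : ℂ) • (R (g x x') (Ψ x') - Ψ x) + ((z x' - z x : ℝ) : ℂ) • R (g x x') (Ψ x') := by
      rw [R_smul, smul_sub, Complex.ofReal_sub, sub_smul]; abel
    rw [hsplit]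
    calc wS i α x x' * ‖((z x : ℝ) : ℂ) • (R (g x x') (Ψ x') - Ψ x) + ((z x' - z x : ℝ) : ℂ) • R (g x x') (Ψ x')‖
        ≤ wS i α x x' * (|z x| * ‖Ψ x - R (g x x') (Ψ x')‖ + |z x' - z x| * ‖R (g x x') (Ψ x')‖) := by
          refine mul_le_mul_of_nonneg_left ((norm_add_le _ _).trans ?_) (wS_nonneg i α x x')
          rw [hns, hns, norm_sub_rev]
      _ = |z x| * (wS i α x x' * ‖Ψ x - R (g x x') (Ψ x')‖) + (|z x' - z x| * wS i α x x') * ‖R (g x x') (Ψ x')‖ := by ring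
      _ ≤ S₀ * c + hqTP (toKT i) α z * c := add_le_add (mul_le_mul (hzS x) (hpair x x' hx) (mul_nonneg (wS_nonneg i α x x') (norm_nonneg _)) hS₀0)
          (mul_le_mul hzH (hptR x x' hx') (norm_nonneg _) hHz0)
      _ = c * hqTP (toKT i) α z + c * S₀ := by ring

end Site

/-! ## §2 ★★ The (3.43) co-reading `H1ReadsNbr` of `kernelFamilyS` on the site coordinate model with the Hölder probes -/

section H1

variable [FiniteDimensional ℝ 𝔸] (i : KIdx d ℓ hd hL b₀ b₁) (b : Module.Basis κ ℝ 𝔸)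
variable (B : B9.Backgrounds) (cfg : B.Cfg → CfgY 𝔸 i) (O : SiteOpY 𝔸 i) (par : SiteParY 𝔸 i) (U₁ : B.Cfg)
variable {bI : FBondY i → IBondY i}

omit [Fintype κ] in
/-- the site-sector evaluation of `.inl f` IS the diagonal evaluation of `f`. [cite: Balaban1985BackgroundPropagators, (3.39) p.397, bookkeeping] -/
private theorem evSK_inl' (f : SiteY i → ℝ) : evSK (κ := κ) i (Sum.inl f) = evDiagK f := rfl

/-- ★★ **`H1ReadsNbr (kernelFamilyS i B cfg O par) U₁ (holderProbesS …) (RelB i) r (blkSK (sIK bI)) (blkSK (sIK bI)) evSK evSK (DcoS ∘ₗ GcoS) (GcoS ∘ₗ DscoS)`**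
for EVERY site-sector letter `O`, EVERY `U₁`, every real basis `b`, every radius `r ≥ 1`, given `bI` carrier-faithful (`hβI`) and 1-faithful (`hβ1`): def-Y's
`kernelFamilyS.h1` — `sup_{‖E‖≤1} sup_{(μ, side)} hqS (U(Γ)) α (ζη·∇^η_{U,μ}O(f⊗E) ∕ ζη·O∇^{η*}_{U,μ}(f⊗E))` — is co-read by the models of `∇_UO`, `O∇*_U` through
the site Hölder probes (`hqS_le_of_probes` twice). [cite: Balaban1985BackgroundPropagators, (3.43) p.398 + (3.40)–(3.42) p.397; Balaban1984PropagatorsII, (2.51)–(2.52) p.232 + (2.67) p.234] -/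
theorem h1ReadsNbr_kernelFamilyS_coords [Fintype (geo9K i).Site]
    (hβI : ∀ (x : FBondY i) (c : IBondY i), blkV1 i.hN i.D x = β i.hN i.D i.hk c → β i.hN i.D i.hk (bI x) = blkV1 i.hN i.D x)
    (hβ1 : ∀ x : FBondY i, (geomT i.D).dist (β i.hN i.D i.hk (bI x)) (blkV1 i.hN i.D x) ≤ 1) {r : ℝ} (hr : 1 ≤ r) :
    H1ReadsNbr (kernelFamilyS i B cfg O par) U₁ (holderProbesS i b B cfg par bI) (RelB i) r (blkSK i (sIK i bI)) (blkSK i (sIK i bI))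
      (evSK i) (evSK i) (DcoS i b B cfg U₁ ∘ₗ GcoS i b B cfg O U₁) (GcoS i b B cfg O U₁ ∘ₗ DscoS i b B cfg U₁) := by
  obtain ⟨hoff, hbd⟩ := off_bound_evSK (κ := κ) i (sIK_faithful i hβI)
  refine ⟨hoff, hbd, hoff, hbd, fun lam => geo9K_supNorm_nonneg i lam, fun α ζ => geo9K_cutH_nonneg i α ζ, ?_⟩
  intro lam α ζ y c hc hcut hPY hPX
  have h0 : 0 ≤ c * (geo9K i).cutH α ζ := mul_nonneg hc (geo9K_cutH_nonneg i α ζ)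
  cases lam with
  | inr J => cases ζ with
    | inl zz => exact h0
    | inr zz => exact h0
  | inl f => cases ζ with
    | inr zz => exact h0
    | inl zz =>
        show (⨆ E : BallY 𝔸, hLatS i O par (cfg U₁) (liftY f (E : 𝔸)) α zz) ≤ c * (geoTP (toKT i)).cutH α zz
        rw [DcoS_comp_GcoS, evSK_inl'] at hPY
        rw [GcoS_comp_DscoS, evSK_inl'] at hPX
        refine iSup_ball_le (fun E => ?_) h0
        unfold hLatS
        refine Real.iSup_le (fun q => ?_) h0
        split_ifs with hside
        · exact hqS_le_of_probes i b (sIK_dist_le_one i hβ1) hr (par (cfg U₁))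
            (fun ν => (cdSL i (cfg U₁) ν).restrictScalars ℝ ∘ₗ (O (cfg U₁)).restrictScalars ℝ) f α zz y hc hcut hPY E q.1
        · exact hqS_le_of_probes i b (sIK_dist_le_one i hβ1) hr (par (cfg U₁))
            (fun ν => (O (cfg U₁)).restrictScalars ℝ ∘ₗ (cdsSL i (cfg U₁) ν).restrictScalars ℝ) f α zz y hc hcut hPX E q.1

/-- ★ **UNDER THE CERTIFICATE'S SITE PINS, RADIUS 2**: `blk = blkY = blkSK (sIK bI)`, `Gp = GcoS …`, `D = DcoS …`, `Ds = DscoS …` ⇒ `H1ReadsNbr (kernelFamilyS …) U₁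
(holderProbesS …) (RelB i) 2 blk blkY evSK evSK (D ∘ₗ Gp) (Gp ∘ₗ Ds)`. [cite: Balaban1985BackgroundPropagators, (3.43) p.398; Balaban1984PropagatorsII, (2.51)–(2.52) p.232] -/
theorem site_h1ReadsNbr_of_pins [Fintype (geo9K i).Site]
    (hβI : ∀ (x : FBondY i) (c : IBondY i), blkV1 i.hN i.D x = β i.hN i.D i.hk c → β i.hN i.D i.hk (bI x) = blkV1 i.hN i.D x)
    (hβ1 : ∀ x : FBondY i, (geomT i.D).dist (β i.hN i.D i.hk (bI x)) (blkV1 i.hN i.D x) ≤ 1)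
    {blk blkY : XSK κ i → IBondY i} {G D Ds : (XSK κ i → ℝ) →ₗ[ℝ] (XSK κ i → ℝ)} (hblk : blk = blkSK i (sIK i bI)) (hblkY : blkY = blkSK i (sIK i bI))
    (hG : G = GcoS i b B cfg O U₁) (hD : D = DcoS i b B cfg U₁) (hDs : Ds = DscoS i b B cfg U₁) :
    H1ReadsNbr (kernelFamilyS i B cfg O par) U₁ (holderProbesS i b B cfg par bI) (RelB i) 2 blk blkY (evSK i) (evSK i) (D ∘ₗ G) (G ∘ₗ Ds) := by
  subst hblk hblkY hG hD hDs
  exact h1ReadsNbr_kernelFamilyS_coords i b B cfg O par U₁ hβI hβ1 (by norm_num)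

end H1

end Literature.MathematicalPhysics.QuantumFieldTheory.Balaban1983to89.B9CoReadingCoordsHolderS

end
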